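import Mathlib
import HarnessLib
import Summits.Ventures.LatticeQCDFlow.Exactness.SU2FTHMCGaugeCovariance

/-!
# What gauge covariance of the FT-HMC kernel means for measurements: class-function observables have the same law and the same expectations along the run from `V` and from `V^h`, at every time

HONEST FRAMING: exact (Metropolis-corrected) sampling algorithms for lattice gauge theory;
figures of merit are autocorrelation/cost numbers at stated couplings and volumes; no
continuum-physics claim.

Venture `LatticeQCDFlow` (cell pub-lqcd), topic `Exactness`; FANOUT row 14 (`eng-flowhmc`; the
engine measures gauge-invariant observables — plaquette, topological charge, Wilson loops — along
the FT-HMC run).  NEW WORK of the cell; nothing is cited as a fact; no number.  The symmetry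
`conjKernel K Θ = K` of `FTHMCKernelCovariance` / `SU2FTHMCGaugeCovariance`, read on observables:

* any measurable space: `map_apply_eq_of_conjKernel_eq_self` (`K(Θ y) = Θ_* K(y)` as measures),
  `lintegral_comp_eq_of_conjKernel_eq_self` / `integral_comp_eq_of_conjKernel_eq_self`
  (`∫ f dK(Θ y) = ∫ f∘Θ dK(y)`), **`integral_eq_of_conjKernel_eq_self`** (a `Θ`-invariant `f` has the
  same one-step expectation from `y` and from `Θ y`), the `t`-step versions through `nHit`
  (`integral_nHit_eq_of_conjKernel_eq_self`) and through the law of the run from any initial law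
  (`integral_iterate_bind_map_eq_of_conjKernel_eq_self`);
* THE `SU(2)` RUNG: **`su2_fthmc_integral_gaugeInvariant_eq`** — for every gauge-invariant
  observable `O`, every `t`, every initial law `μ₀` and every gauge transformation `h`, the
  expectation of `O` after `t` steps of the engine's FT-HMC kernel (equivariant member, invariant
  `J`, `S`, covariant force routine) started from `(Θ_h)_* μ₀` equals the one started from `μ₀`;
  `su2_fthmc_nHit_integral_gaugeInvariant_eq` — the same for the `t`-step kernel from `V^h` vs `V`.

NOT CLAIMED: anything about WHICH observables the engine measures or their estimators; any number.
-/

noncomputable section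

namespace Summit.Ventures.LatticeQCDFlow.Exactness

open WithLp Set MeasureTheory
open ProbabilityTheory ProbabilityTheory.Kernel
open Literature.MathematicalPhysics.QuantumFieldTheory Literature.Barriers.QuantumFields
open scoped ENNReal Matrix

/-! ## Any measurable space -/

section Meaning

variable {Ω : Type*} [MeasurableSpace Ω]

/-- `K(Θ y) = Θ_* K(y)` as measures. -/
theorem map_apply_eq_of_conjKernel_eq_self {κ : Kernel Ω Ω} {Θ : Ω ≃ᵐ Ω} (hκ : conjKernel κ Θ = κ)
    (y : Ω) : (κ y).map Θ = κ (Θ y) := by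
  ext s hs
  rw [Measure.map_apply Θ.measurable hs, apply_eq_of_conjKernel_eq_self hκ y hs]

/-- `∫⁻ f dK(Θ y) = ∫⁻ f∘Θ dK(y)`. -/
theorem lintegral_comp_eq_of_conjKernel_eq_self {κ : Kernel Ω Ω} {Θ : Ω ≃ᵐ Ω}
    (hκ : conjKernel κ Θ = κ) (y : Ω) (f : Ω → ℝ≥0∞) :
    ∫⁻ x, f x ∂(κ (Θ y)) = ∫⁻ x, f (Θ x) ∂(κ y) := by
  rw [← map_apply_eq_of_conjKernel_eq_self hκ y, lintegral_map_equiv]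

/-- `∫ f dK(Θ y) = ∫ f∘Θ dK(y)` (Bochner). -/
theorem integral_comp_eq_of_conjKernel_eq_self {E : Type*} [NormedAddCommGroup E] [NormedSpace ℝ E]
    {κ : Kernel Ω Ω} {Θ : Ω ≃ᵐ Ω} (hκ : conjKernel κ Θ = κ) (y : Ω) (f : Ω → E) :
    ∫ x, f x ∂(κ (Θ y)) = ∫ x, f (Θ x) ∂(κ y) := by
  rw [← map_apply_eq_of_conjKernel_eq_self hκ y, integral_map_equiv]

/-- **A `Θ`-invariant observable has the same one-step expectation from `y` and from `Θ y`.** -/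
theorem integral_eq_of_conjKernel_eq_self {E : Type*} [NormedAddCommGroup E] [NormedSpace ℝ E]
    {κ : Kernel Ω Ω} {Θ : Ω ≃ᵐ Ω} (hκ : conjKernel κ Θ = κ) (y : Ω) {f : Ω → E}
    (hf : ∀ x, f (Θ x) = f x) : ∫ x, f x ∂(κ (Θ y)) = ∫ x, f x ∂(κ y) := by
  rw [integral_comp_eq_of_conjKernel_eq_self hκ y f]
  simp only [hf]

/-- … and the same `t`-step expectation (`nHit κ t`). -/
theorem integral_nHit_eq_of_conjKernel_eq_self {E : Type*} [NormedAddCommGroup E] [NormedSpace ℝ E]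
    {κ : Kernel Ω Ω} {Θ : Ω ≃ᵐ Ω} (hκ : conjKernel κ Θ = κ) (t : ℕ) (y : Ω) {f : Ω → E}
    (hf : ∀ x, f (Θ x) = f x) : ∫ x, f x ∂(nHit κ t (Θ y)) = ∫ x, f x ∂(nHit κ t y) :=
  integral_eq_of_conjKernel_eq_self (conjKernel_nHit_eq_self hκ t) y hf

/-- **From any initial law**: a `Θ`-invariant observable has the same expectation after `t` steps
of the run started from `Θ_* μ₀` as after `t` steps started from `μ₀`. -/
theorem integral_iterate_bind_map_eq_of_conjKernel_eq_self {E : Type*} [NormedAddCommGroup E]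
    [NormedSpace ℝ E] {κ : Kernel Ω Ω} {Θ : Ω ≃ᵐ Ω} (hκ : conjKernel κ Θ = κ) (μ₀ : Measure Ω)
    (t : ℕ) {f : Ω → E} (hf : ∀ x, f (Θ x) = f x) :
    ∫ x, f x ∂((fun m : Measure Ω => m.bind κ)^[t] (μ₀.map Θ)) =
      ∫ x, f x ∂((fun m : Measure Ω => m.bind κ)^[t] μ₀) := by
  rw [iterate_bind_map_of_conjKernel_eq_self hκ μ₀ t, integral_map_equiv]
  simp only [hf]

end Meaning

/-! ## The `SU(2)` rung -/

section SU2

variable {d L : ℕ} [NeZero L]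

/-- **Gauge-invariant observables have the same expectation along the engine's FT-HMC run from
`(Θ_h)_* μ₀` and from `μ₀`, at every time `t`** (equivariant member `F`, invariant measurable `J`,
`S`, covariant measurable force routine; any `c`, `n`, `h`, `μ₀`). -/
theorem su2_fthmc_integral_gaugeInvariant_eq (h : Site d L → Matrix.specialUnitaryGroup (Fin 2) ℂ)
    (F : GaugeConfig d L (Matrix.specialUnitaryGroup (Fin 2) ℂ) ≃ᵐ GaugeConfig d L (Matrix.specialUnitaryGroup (Fin 2) ℂ)) (hF : IsGaugeEquivariant (⇑F))
    {J : GaugeConfig d L (Matrix.specialUnitaryGroup (Fin 2) ℂ) → ℝ} (hJm : Measurable J) (hJ : IsGaugeInvariant J)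
    {S : GaugeConfig d L (Matrix.specialUnitaryGroup (Fin 2) ℂ) → ℝ} (hS : Measurable S) (hSi : IsGaugeInvariant S) (c : ℝ)
    {g : GaugeConfig d L (Matrix.specialUnitaryGroup (Fin 2) ℂ) → ((Edge d L × Fin 3) → ℝ)} (hg : Measurable g)
    (hgc : ∀ V : GaugeConfig d L (Matrix.specialUnitaryGroup (Fin 2) ℂ), g (gaugeTransform h V) =
      (fun q : Edge d L × Fin 3 => (vecQuat (((h q.1.1 : Matrix.specialUnitaryGroup (Fin 2) ℂ) : Matrix (Fin 2) (Fin 2) ℂ) * quatVec (toLp 2 ![0, g V (q.1, 0), g V (q.1, 1), g V (q.1, 2)]) * (((h q.1.1 : Matrix.specialUnitaryGroup (Fin 2) ℂ) : Matrix (Fin 2) (Fin 2) ℂ))ᴴ)) q.2.succ)) (n : ℕ)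
    {E : Type*} [NormedAddCommGroup E] [NormedSpace ℝ E] {O : GaugeConfig d L (Matrix.specialUnitaryGroup (Fin 2) ℂ) → E} (hO : IsGaugeInvariant O)
    (μ₀ : Measure (GaugeConfig d L (Matrix.specialUnitaryGroup (Fin 2) ℂ))) (t : ℕ) :
    ∫ U, O U ∂((fun m : Measure (GaugeConfig d L (Matrix.specialUnitaryGroup (Fin 2) ℂ)) => m.bind
      (conjKernel
        (refreshUpdate
          (involMH
            (⇑((flip : Equiv.Perm (GaugeConfig d L (Matrix.specialUnitaryGroup (Fin 2) ℂ) × ((Edge d L × Fin 3) → ℝ))) *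
                leapfrog (mulDrift fun p : ((Edge d L × Fin 3) → ℝ) =>
                  fun ℓ : Edge d L => gaussUnit (toLp 2
          ![Real.cos (c * Real.sqrt (p (ℓ, 0) ^ 2 + p (ℓ, 1) ^ 2 + p (ℓ, 2) ^ 2)),
            c * Real.sinc (c * Real.sqrt (p (ℓ, 0) ^ 2 + p (ℓ, 1) ^ 2 + p (ℓ, 2) ^ 2)) * p (ℓ, 0),
            c * Real.sinc (c * Real.sqrt (p (ℓ, 0) ^ 2 + p (ℓ, 1) ^ 2 + p (ℓ, 2) ^ 2)) * p (ℓ, 1),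
            c * Real.sinc (c * Real.sqrt (p (ℓ, 0) ^ 2 + p (ℓ, 1) ^ 2 + p (ℓ, 2) ^ 2)) * p (ℓ, 2)])) g ^ n))
            (measurable_flip_leapfrog_pow (measurable_mulDrift (measurable_su2Drift c)) hg n)
            fun z : GaugeConfig d L (Matrix.specialUnitaryGroup (Fin 2) ℂ) × ((Edge d L × Fin 3) → ℝ) =>
              (S (F z.1) - Real.log (J z.1)) + ∑ i, z.2 i ^ 2 / 2)
          ((((volume : Measure ((Edge d L × Fin 3) → ℝ)).withDensity
                  fun p => ENNReal.ofReal (Real.exp (-(∑ i, p i ^ 2 / 2)))) Set.univ)⁻¹ •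
              (volume : Measure ((Edge d L × Fin 3) → ℝ)).withDensity
                fun p => ENNReal.ofReal (Real.exp (-(∑ i, p i ^ 2 / 2)))))
        F))^[t]
      (μ₀.map (gaugeTransform h))) =
    ∫ U, O U ∂((fun m : Measure (GaugeConfig d L (Matrix.specialUnitaryGroup (Fin 2) ℂ)) => m.bind
      (conjKernel
        (refreshUpdate
          (involMH
            (⇑((flip : Equiv.Perm (GaugeConfig d L (Matrix.specialUnitaryGroup (Fin 2) ℂ) × ((Edge d L × Fin 3) → ℝ))) *
                leapfrog (mulDrift fun p : ((Edge d L × Fin 3) → ℝ) =>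
                  fun ℓ : Edge d L => gaussUnit (toLp 2
          ![Real.cos (c * Real.sqrt (p (ℓ, 0) ^ 2 + p (ℓ, 1) ^ 2 + p (ℓ, 2) ^ 2)),
            c * Real.sinc (c * Real.sqrt (p (ℓ, 0) ^ 2 + p (ℓ, 1) ^ 2 + p (ℓ, 2) ^ 2)) * p (ℓ, 0),
            c * Real.sinc (c * Real.sqrt (p (ℓ, 0) ^ 2 + p (ℓ, 1) ^ 2 + p (ℓ, 2) ^ 2)) * p (ℓ, 1),
            c * Real.sinc (c * Real.sqrt (p (ℓ, 0) ^ 2 + p (ℓ, 1) ^ 2 + p (ℓ, 2) ^ 2)) * p (ℓ, 2)])) g ^ n))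
            (measurable_flip_leapfrog_pow (measurable_mulDrift (measurable_su2Drift c)) hg n)
            fun z : GaugeConfig d L (Matrix.specialUnitaryGroup (Fin 2) ℂ) × ((Edge d L × Fin 3) → ℝ) =>
              (S (F z.1) - Real.log (J z.1)) + ∑ i, z.2 i ^ 2 / 2)
          ((((volume : Measure ((Edge d L × Fin 3) → ℝ)).withDensity
                  fun p => ENNReal.ofReal (Real.exp (-(∑ i, p i ^ 2 / 2)))) Set.univ)⁻¹ •
              (volume : Measure ((Edge d L × Fin 3) → ℝ)).withDensity
                fun p => ENNReal.ofReal (Real.exp (-(∑ i, p i ^ 2 / 2)))))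
        F))^[t] μ₀) :=
  integral_iterate_bind_map_eq_of_conjKernel_eq_self
    (su2_fthmc_conjKernel_gaugeTransform h F hF hJm hJ hS hSi c hg hgc n) μ₀ t (fun U => hO h U)

/-- **… and from the configurations `V^h` and `V`, through the `t`-step kernel `nHit K t`.** -/
theorem su2_fthmc_nHit_integral_gaugeInvariant_eq (h : Site d L → Matrix.specialUnitaryGroup (Fin 2) ℂ)
    (F : GaugeConfig d L (Matrix.specialUnitaryGroup (Fin 2) ℂ) ≃ᵐ GaugeConfig d L (Matrix.specialUnitaryGroup (Fin 2) ℂ)) (hF : IsGaugeEquivariant (⇑F))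
    {J : GaugeConfig d L (Matrix.specialUnitaryGroup (Fin 2) ℂ) → ℝ} (hJm : Measurable J) (hJ : IsGaugeInvariant J)
    {S : GaugeConfig d L (Matrix.specialUnitaryGroup (Fin 2) ℂ) → ℝ} (hS : Measurable S) (hSi : IsGaugeInvariant S) (c : ℝ)
    {g : GaugeConfig d L (Matrix.specialUnitaryGroup (Fin 2) ℂ) → ((Edge d L × Fin 3) → ℝ)} (hg : Measurable g)
    (hgc : ∀ V : GaugeConfig d L (Matrix.specialUnitaryGroup (Fin 2) ℂ), g (gaugeTransform h V) =
      (fun q : Edge d L × Fin 3 => (vecQuat (((h q.1.1 : Matrix.specialUnitaryGroup (Fin 2) ℂ) : Matrix (Fin 2) (Fin 2) ℂ) * quatVec (toLp 2 ![0, g V (q.1, 0), g V (q.1, 1), g V (q.1, 2)]) * (((h q.1.1 : Matrix.specialUnitaryGroup (Fin 2) ℂ) : Matrix (Fin 2) (Fin 2) ℂ))ᴴ)) q.2.succ)) (n : ℕ)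
    {E : Type*} [NormedAddCommGroup E] [NormedSpace ℝ E] {O : GaugeConfig d L (Matrix.specialUnitaryGroup (Fin 2) ℂ) → E} (hO : IsGaugeInvariant O)
    (t : ℕ) (V : GaugeConfig d L (Matrix.specialUnitaryGroup (Fin 2) ℂ)) :
    ∫ U, O U ∂(nHit
      (conjKernel
        (refreshUpdate
          (involMH
            (⇑((flip : Equiv.Perm (GaugeConfig d L (Matrix.specialUnitaryGroup (Fin 2) ℂ) × ((Edge d L × Fin 3) → ℝ))) *
                leapfrog (mulDrift fun p : ((Edge d L × Fin 3) → ℝ) =>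
                  fun ℓ : Edge d L => gaussUnit (toLp 2
          ![Real.cos (c * Real.sqrt (p (ℓ, 0) ^ 2 + p (ℓ, 1) ^ 2 + p (ℓ, 2) ^ 2)),
            c * Real.sinc (c * Real.sqrt (p (ℓ, 0) ^ 2 + p (ℓ, 1) ^ 2 + p (ℓ, 2) ^ 2)) * p (ℓ, 0),
            c * Real.sinc (c * Real.sqrt (p (ℓ, 0) ^ 2 + p (ℓ, 1) ^ 2 + p (ℓ, 2) ^ 2)) * p (ℓ, 1),
            c * Real.sinc (c * Real.sqrt (p (ℓ, 0) ^ 2 + p (ℓ, 1) ^ 2 + p (ℓ, 2) ^ 2)) * p (ℓ, 2)])) g ^ n))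
            (measurable_flip_leapfrog_pow (measurable_mulDrift (measurable_su2Drift c)) hg n)
            fun z : GaugeConfig d L (Matrix.specialUnitaryGroup (Fin 2) ℂ) × ((Edge d L × Fin 3) → ℝ) =>
              (S (F z.1) - Real.log (J z.1)) + ∑ i, z.2 i ^ 2 / 2)
          ((((volume : Measure ((Edge d L × Fin 3) → ℝ)).withDensity
                  fun p => ENNReal.ofReal (Real.exp (-(∑ i, p i ^ 2 / 2)))) Set.univ)⁻¹ •
              (volume : Measure ((Edge d L × Fin 3) → ℝ)).withDensity
                fun p => ENNReal.ofReal (Real.exp (-(∑ i, p i ^ 2 / 2)))))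
        F) t
      (gaugeTransform h V)) =
    ∫ U, O U ∂(nHit
      (conjKernel
        (refreshUpdate
          (involMH
            (⇑((flip : Equiv.Perm (GaugeConfig d L (Matrix.specialUnitaryGroup (Fin 2) ℂ) × ((Edge d L × Fin 3) → ℝ))) *
                leapfrog (mulDrift fun p : ((Edge d L × Fin 3) → ℝ) =>
                  fun ℓ : Edge d L => gaussUnit (toLp 2
          ![Real.cos (c * Real.sqrt (p (ℓ, 0) ^ 2 + p (ℓ, 1) ^ 2 + p (ℓ, 2) ^ 2)),
            c * Real.sinc (c * Real.sqrt (p (ℓ, 0) ^ 2 + p (ℓ, 1) ^ 2 + p (ℓ, 2) ^ 2)) * p (ℓ, 0),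
            c * Real.sinc (c * Real.sqrt (p (ℓ, 0) ^ 2 + p (ℓ, 1) ^ 2 + p (ℓ, 2) ^ 2)) * p (ℓ, 1),
            c * Real.sinc (c * Real.sqrt (p (ℓ, 0) ^ 2 + p (ℓ, 1) ^ 2 + p (ℓ, 2) ^ 2)) * p (ℓ, 2)])) g ^ n))
            (measurable_flip_leapfrog_pow (measurable_mulDrift (measurable_su2Drift c)) hg n)
            fun z : GaugeConfig d L (Matrix.specialUnitaryGroup (Fin 2) ℂ) × ((Edge d L × Fin 3) → ℝ) =>
              (S (F z.1) - Real.log (J z.1)) + ∑ i, z.2 i ^ 2 / 2)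
          ((((volume : Measure ((Edge d L × Fin 3) → ℝ)).withDensity
                  fun p => ENNReal.ofReal (Real.exp (-(∑ i, p i ^ 2 / 2)))) Set.univ)⁻¹ •
              (volume : Measure ((Edge d L × Fin 3) → ℝ)).withDensity
                fun p => ENNReal.ofReal (Real.exp (-(∑ i, p i ^ 2 / 2)))))
        F) t V) :=
  integral_nHit_eq_of_conjKernel_eq_self
    (su2_fthmc_conjKernel_gaugeTransform h F hF hJm hJ hS hSi c hg hgc n) t V (fun U => hO h U)

end SU2

end Summit.Ventures.LatticeQCDFlow.Exactness
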